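import Mathlib.Data.Finset.Sort
import Literature.Computability.Complexity.FourierDegree
import Literature.Computability.Complexity.SwitchingLemma
import HarnessLib

/-!
# Midrijanis' bound `D(f) ≤ bs(f) · deg(f)`

G. Midrijanis, *Exact quantum query complexity for total Boolean functions*, arXiv:quant-ph/0403168
(2004), **Theorem 4** (proof): "in every cycle `𝒜` makes at most `deg(f)` queries, hence
`D(f) ≤ deg(f) · bs(f)`" — the classical ingredient of Aaronson–Ben-David–Kothari–Rao–Tal's
`D(f) = O(Q(f)⁴)` (STOC 2021, proof of Thm. 1: "Midrijanis [Mid04] showed that for all total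
functions `f`, `D(f) ≤ bs(f) deg(f)`"). Measures: `detQueryComplexity` (`DecisionTree.lean`),
`blockSensitivity` (`BlockSensitivity.lean`), `booleanDegree` (`FourierDegree.lean`).

**The printed algorithm** `𝒜` (p. 5): "1. `p := f`; 2. While `p` is not constant { 3. Pick
maxonomial `M` in polynomial `p`; 4. Query `X`-values of `M`'s variables; 5. Replace all queried
variables in `p` with appropriate constants }; 6. Return `p`." As a decision tree:
`midrijanisTree f k J σ` runs at most `k` further cycles from the restriction `p = f|_{J ← σ}`
(`fun x => f (J.piecewise σ x)`), a cycle being the tree's block query `queryList`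
(`SwitchingLemma.lean`, with `accAnswers`, `eval_queryList`, `depth_queryList_le`) over the
variables of the chosen `maxonomial`, followed by the recursive call on the enlarged restriction.

**The printed analysis.** Correctness: "polynomial `p` always describes polynomial `f` on word
`X`". Number of cycles: "after `a - 1` executions of cycle `X` has at least `a - 1` disjoint
blocks that take their variables only from yet queried variables and to which `f` is sensitive
on `X` … in the next cycle execution there exists a block `B` that takes its variables only from
variables queried in this cycle", by Lemma 3 (`exists_sensitive_block_subset_maxonomial`,
`FourierDegree.lean`) — here `exists_family_of_eval_ne`: if after `k` cycles on the path of `x` the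
restriction is still not constant, `x` carries `k + 1` pairwise disjoint sensitive blocks; so
`k = bs(f)` cycles suffice (`midrijanisTree_computes`). Cost: "for every maxonomial `M` holds
`|M| = deg(p)` and at every moment `deg(p) ≤ deg(f)`" (`depth_midrijanisTree_le`), whence
`detQueryComplexity_le_blockSensitivity_mul_booleanDegree`.

Design note. The algorithm-specific objects live in the sub-namespace `Midrijanis`; only the
final bound is directory-level. The current restriction is carried as a pair `(J, σ)` (queried set,
recorded values; consistency of an input is Mathlib's `Set.EqOn x σ ↑J`) and read through
Mathlib's `J.piecewise σ`, because the degree/maxonomial lemmas of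
`FourierDegree.lean` (`booleanDegree_piecewise_le`, `cubeFourierCoeff_piecewise_of_maxonomial`,
after O'Donnell's restriction formula `cubeFourierCoeff_piecewise`) are stated for exactly these
restrictions. The sibling `CertificateAlgorithm.lean` (Beals et al. Lemma 5.3,
`D(f) ≤ C⁽¹⁾(f) bs(f)`, landed concurrently) runs the analogous round structure on knowledge
functions `ρ : Fin N → Option Bool` (`queryBlock`/`assign` there, the same shape as the reused
`queryList`/`accAnswers`).

## References

* G. Midrijanis, *Exact quantum query complexity for total Boolean functions*,
  arXiv:quant-ph/0403168 (2004), Lemma 3, Theorem 4 and its proof (p. 5) [Midrijanis2004].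
* S. Aaronson, S. Ben-David, R. Kothari, S. Rao, A. Tal, *Degree vs. approximate degree and
  quantum implications of Huang's sensitivity theorem*, STOC 2021, §1 (proof of Thm. 1)
  [AaronsonBenDavidKothariRaoTal2021].
-/

noncomputable section

namespace Literature.Computability.Complexity

open Finset LowDegree DecisionTree

variable {N : ℕ}

namespace Midrijanis

/-! ### A chosen maxonomial -/

/-- A non-constant Boolean function has a maxonomial (Boolean form of `exists_maxonomial`).
[cite: Midrijanis2004, §3] -/
theorem exists_boolean_maxonomial {g : (Fin N → Bool) → Bool} {x y : Fin N → Bool}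
    (hxy : g x ≠ g y) : ∃ S : Finset (Fin N), S.Nonempty ∧ cubeFourierCoeff (realOf g) S ≠ 0 ∧
      S.card = booleanDegree g :=
  exists_maxonomial (g := realOf g) fun h => hxy ((realOf_eq_realOf_iff g x y).mp h)

open Classical in
/-- A chosen maxonomial of `g` ("pick maxonomial `M` in polynomial `p` … choosing the first
maxonomial in some fixed order"); `∅` if `g` is constant. [cite: Midrijanis2004, Thm 4 (proof)] -/
def maxonomial (g : (Fin N → Bool) → Bool) : Finset (Fin N) :=
  if h : ∃ S : Finset (Fin N), S.Nonempty ∧ cubeFourierCoeff (realOf g) S ≠ 0 ∧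
      S.card = booleanDegree g then Classical.choose h else ∅

/-- For non-constant `g`, the chosen maxonomial is a genuine maxonomial. [cite: Midrijanis2004,
Thm 4 (proof)] -/
theorem maxonomial_spec {g : (Fin N → Bool) → Bool} {x y : Fin N → Bool} (hxy : g x ≠ g y) :
    (maxonomial g).Nonempty ∧ cubeFourierCoeff (realOf g) (maxonomial g) ≠ 0 ∧
      (maxonomial g).card = booleanDegree g := by
  have h := exists_boolean_maxonomial hxy
  rw [maxonomial, dif_pos h]
  exact Classical.choose_spec h

/-- `|maxonomial g| ≤ deg g` ("for every maxonomial `M` holds `|M| = deg(p)`"). [cite: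
Midrijanis2004, Thm 4 (proof)] -/
theorem card_maxonomial_le (g : (Fin N → Bool) → Bool) :
    (maxonomial g).card ≤ booleanDegree g := by
  unfold maxonomial
  split_ifs with h
  · exact (Classical.choose_spec h).2.2.le
  · simp

/-! ### Midrijanis' decision tree -/

open Classical in
/-- **Midrijanis' algorithm** as a decision tree with at most `k` further cycles, started from
the restriction `p = f|_{J ← σ}`: if `p` is constant, output it; otherwise query the variables of
a maxonomial of `p` and recurse on the enlarged restriction. (With no cycles left, output `f σ`.)
[cite: Midrijanis2004, Thm 4 (the algorithm 𝒜)] -/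
def midrijanisTree (f : (Fin N → Bool) → Bool) : ℕ → Finset (Fin N) → (Fin N → Bool) →
    DecisionTree N
  | 0, _, σ => DecisionTree.leaf (f σ)
  | k + 1, J, σ =>
    if ∀ x y, f (J.piecewise σ x) = f (J.piecewise σ y) then DecisionTree.leaf (f σ)
    else queryList ((maxonomial fun x => f (J.piecewise σ x)).sort (· ≤ ·))
      (fun τ => midrijanisTree f k (J ∪ maxonomial fun x => f (J.piecewise σ x)) τ) σ

/-- **Cost**: `k` cycles cost at most `k · deg(f)` queries ("in every cycle `𝒜` makes at most
`deg(f)` queries"). [cite: Midrijanis2004, Thm 4 (proof)] -/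
theorem depth_midrijanisTree_le (f : (Fin N → Bool) → Bool) :
    ∀ (k : ℕ) (J : Finset (Fin N)) (σ : Fin N → Bool),
      (midrijanisTree f k J σ).depth ≤ k * booleanDegree f
  | 0, J, σ => by simp [midrijanisTree]
  | k + 1, J, σ => by
    rw [midrijanisTree]
    split_ifs with h
    · simp
    · refine (depth_queryList_le (fun τ => depth_midrijanisTree_le f k _ τ) _ _).trans ?_
      rw [Finset.length_sort]
      have h1 := card_maxonomial_le fun x => f (J.piecewise σ x)
      have h2 := booleanDegree_piecewise_le f J σ
      rw [Nat.succ_mul]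
      omega

/-- A consistent input (`x = σ` on the queried set `J`, Mathlib's `Set.EqOn x σ ↑J`) is its own
restriction: `x|_{J ← σ} = x`. [folklore] -/
theorem piecewise_eq_of_eqOn {σ x : Fin N → Bool} {J : Finset (Fin N)}
    (h : Set.EqOn x σ (J : Set (Fin N))) : J.piecewise σ x = x := by
  classical
  funext i
  by_cases hi : i ∈ J
  · rw [Finset.piecewise_eq_of_mem _ _ _ hi, h (Finset.mem_coe.mpr hi)]
  · rw [Finset.piecewise_eq_of_notMem _ _ _ hi]

/-- Flipping a block disjoint from `J` preserves consistency on `J`. [folklore] -/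
theorem eqOn_flipBlock {σ x : Fin N → Bool} {J B : Finset (Fin N)}
    (h : Set.EqOn x σ (J : Set (Fin N))) (hB : Disjoint B J) :
    Set.EqOn (flipBlock x B) σ (J : Set (Fin N)) := fun i hi => by
  rw [flipBlock_apply_of_not_mem fun hiB => Finset.disjoint_left.mp hB hiB (Finset.mem_coe.mp hi),
    h hi]

/-- A maxonomial of a restriction `f|_{J ← σ}` avoids `J` (restricted functions do not depend on
the fixed coordinates). [cite: Midrijanis2004, Thm 4 (proof: "a block that takes its variables
only from variables queried in this cycle (therefore is disjoint with previous ones)")] -/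
theorem disjoint_maxonomial_piecewise (f : (Fin N → Bool) → Bool) (J : Finset (Fin N))
    (σ : Fin N → Bool) {x y : Fin N → Bool}
    (hxy : f (J.piecewise σ x) ≠ f (J.piecewise σ y)) :
    Disjoint (maxonomial fun z => f (J.piecewise σ z)) J := by
  have hspec := maxonomial_spec (g := fun z => f (J.piecewise σ z)) hxy
  rw [Finset.disjoint_left]
  intro i hi hiJ
  exact hspec.2.1 (cubeFourierCoeff_piecewise_eq_zero (realOf f) J σ ⟨i, hi, hiJ⟩)

/-- **One more block per cycle** (Midrijanis' induction step, via Lemma 3): if the restriction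
`f|_{J ← σ}` is not constant and `x` is consistent with `σ` on `J`, then `x` has a sensitive block
inside the chosen maxonomial (hence disjoint from `J`). [cite: Midrijanis2004, Thm 4 (proof) and
Lemma 3] -/
theorem exists_sensitive_block_subset_maxonomial_piecewise (f : (Fin N → Bool) → Bool)
    (J : Finset (Fin N)) (σ : Fin N → Bool) {x₁ y₁ : Fin N → Bool}
    (hxy : f (J.piecewise σ x₁) ≠ f (J.piecewise σ y₁)) {x : Fin N → Bool}
    (hx : Set.EqOn x σ (J : Set (Fin N))) :
    ∃ B ⊆ maxonomial (fun z => f (J.piecewise σ z)), f (flipBlock x B) ≠ f x := by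
  have hspec := maxonomial_spec (g := fun z => f (J.piecewise σ z)) hxy
  obtain ⟨B, hB, hsens⟩ := exists_sensitive_block_subset_maxonomial
    (fun z => f (J.piecewise σ z)) hspec.1 hspec.2.1 hspec.2.2 x
  refine ⟨B, hB, ?_⟩
  have hBJ : Disjoint B J := (disjoint_maxonomial_piecewise f J σ hxy).mono_left hB
  simpa only [piecewise_eq_of_eqOn hx, piecewise_eq_of_eqOn (eqOn_flipBlock hx hBJ)] using hsens

/-- **The cycle count** (Midrijanis' induction): if `x` is consistent with `σ` on `J` and the
tree with `k` cycles left errs on `x`, then `x` has `k + 1` pairwise disjoint sensitive blocks,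
all disjoint from `J`. [cite: Midrijanis2004, Thm 4 (proof)] -/
theorem exists_family_of_eval_ne (f : (Fin N → Bool) → Bool) :
    ∀ (k : ℕ) (J : Finset (Fin N)) (σ x : Fin N → Bool), Set.EqOn x σ (J : Set (Fin N)) →
      (midrijanisTree f k J σ).eval x ≠ f x →
      ∃ 𝓑 : Finset (Finset (Fin N)), IsSensitiveFamily f x 𝓑 ∧ 𝓑.card = k + 1 ∧
        ∀ B ∈ 𝓑, Disjoint B J
  | 0, J, σ, x, hx, hne => by
    classical
    simp only [midrijanisTree, eval_leaf] at hne
    -- the restriction is not constant: it differs at `σ` and `x`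
    have hxy : f (J.piecewise σ σ) ≠ f (J.piecewise σ x) := by
      rwa [piecewise_self, piecewise_eq_of_eqOn hx]
    obtain ⟨B, hB, hsens⟩ := exists_sensitive_block_subset_maxonomial_piecewise f J σ hxy hx
    have hBJ : Disjoint B J := (disjoint_maxonomial_piecewise f J σ hxy).mono_left hB
    refine ⟨{B}, ⟨by simpa [IsSensitiveBlock] using hsens, by simp⟩, by simp, by simpa using hBJ⟩
  | k + 1, J, σ, x, hx, hne => by
    classical
    rw [midrijanisTree] at hne
    split_ifs at hne with hconst
    · -- constant restriction: the leaf is correct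
      exfalso
      apply hne
      rw [eval_leaf]
      have := hconst σ x
      rwa [piecewise_self, piecewise_eq_of_eqOn hx] at this
    · -- a genuine cycle
      push Not at hconst
      obtain ⟨x₁, y₁, hxy⟩ := hconst
      set S := maxonomial fun z => f (J.piecewise σ z) with hS
      rw [eval_queryList] at hne
      set τ := accAnswers (S.sort (· ≤ ·)) σ x with hτ
      have hxτ : Set.EqOn x τ ((J ∪ S : Finset (Fin N)) : Set (Fin N)) := by
        intro i hi
        rw [Finset.mem_coe] at hi
        by_cases hiS : i ∈ S
        · exact (accAnswers_of_mem x _ σ ((Finset.mem_sort _).mpr hiS)).symm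
        · rcases Finset.mem_union.mp hi with hiJ | hiS'
          · rw [hτ, accAnswers_of_mem.accAnswers_of_not_mem x _ σ
              (fun h => hiS ((Finset.mem_sort _).mp h))]
            exact hx (Finset.mem_coe.mpr hiJ)
          · exact absurd hiS' hiS
      obtain ⟨𝓑, h𝓑, hcard, hdisj⟩ := exists_family_of_eval_ne f k (J ∪ S) τ x hxτ hne
      -- the new block inside `S`
      obtain ⟨B, hBS, hsens⟩ := exists_sensitive_block_subset_maxonomial_piecewise f J σ hxy hx
      have hSJ : Disjoint S J := disjoint_maxonomial_piecewise f J σ hxy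
      have hBne : B.Nonempty := IsSensitiveBlock.nonempty hsens
      have hBdisj : ∀ B' ∈ 𝓑, Disjoint B B' := fun B' hB' =>
        ((hdisj B' hB').mono_right Finset.subset_union_right).symm.mono_left hBS
      have hBnot : B ∉ 𝓑 := fun hB𝓑 => by
        obtain ⟨i, hi⟩ := hBne
        exact Finset.disjoint_left.mp (hBdisj B hB𝓑) hi hi
      refine ⟨insert B 𝓑, ⟨?_, ?_⟩, ?_, ?_⟩
      · intro B' hB'
        rcases Finset.mem_insert.mp hB' with rfl | hB'
        · exact hsens
        · exact h𝓑.1 B' hB'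
      · intro B₁ hB₁ B₂ hB₂ hne'
        rcases Finset.mem_insert.mp hB₁ with rfl | hB₁' <;>
          rcases Finset.mem_insert.mp hB₂ with rfl | hB₂'
        · exact absurd rfl hne'
        · exact hBdisj _ hB₂'
        · exact (hBdisj _ hB₁').symm
        · exact h𝓑.2 hB₁' hB₂' hne'
      · rw [Finset.card_insert_of_notMem hBnot, hcard]
      · intro B' hB'
        rcases Finset.mem_insert.mp hB' with rfl | hB'
        · exact hSJ.mono_left hBS
        · exact (hdisj B' hB').mono_right Finset.subset_union_left

/-- **Correctness with `bs(f)` cycles**: Midrijanis' tree with `bs(f)` cycles computes `f` ("the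
cycle is executed at most `bs_X(f) ≤ bs(f)` times"). [cite: Midrijanis2004, Thm 4 (proof)] -/
theorem midrijanisTree_computes (f : (Fin N → Bool) → Bool) (σ : Fin N → Bool) :
    (midrijanisTree f (blockSensitivity f) ∅ σ).Computes f := by
  intro x
  by_contra hne
  obtain ⟨𝓑, h𝓑, hcard, -⟩ :=
    exists_family_of_eval_ne f (blockSensitivity f) ∅ σ x (fun i hi => by simp at hi) hne
  have := h𝓑.card_le_blockSensitivity
  omega

end Midrijanis

/-- **Midrijanis 2004 (proof of Theorem 4)**: `D(f) ≤ bs(f) · deg(f)` for every total Boolean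
function `f`. [cite: Midrijanis2004, Thm 4 (proof)] -/
theorem detQueryComplexity_le_blockSensitivity_mul_booleanDegree (f : (Fin N → Bool) → Bool) :
    detQueryComplexity f ≤ blockSensitivity f * booleanDegree f :=
  (detQueryComplexity_le_depth _ (Midrijanis.midrijanisTree_computes f fun _ => false)).trans
    (Midrijanis.depth_midrijanisTree_le f _ _ _)

end Literature.Computability.Complexity

end
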